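import Summits.Ventures.PercRepro.C041TriDomExcessWeightedFourAdj

/-!
# ROW C-041 — THE DELETION–CONTRACTION METHOD AT EVERY EDGE PROBABILITY, FOUR MARKS, II: the weighted recursion
(p6, gen 42; P6-TWOEXIT-LEAN.md §53 ADDENDUM 7)

On `C041TriDomExcessWeightedFourAdj`: the weighted sum `sumFW6 F R st w = Σ_ω cwt w ω · F (rsigF6 R st ω) (bsig6 st ω)`
of a four-point functional with forced-red edges `R`, statuses `st` and edge probabilities `w`; **THE WEIGHTED
RECURSION** `sumFW6_rec_ge` (at a free edge `f` of probability `p`: at least `(2p − 1)` times the sum with `f` forced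
red plus `(1 − p)` times the sum of the deletion plus the sum of the contraction — the mixture of a forced-red and a
fair edge, and THE KEY LEMMA); **THE METHOD AT EVERY EDGE PROBABILITY, FOUR MARKS** `sumFW6_nonneg` (`w e ∈ [½, 1]`,
induction on the free edges; the base case `DCAdmissible6.nonneg_of_le6`), `sumFW6_free_nonneg` (every edge free),
the complementation `sumFW6_free_cpl` (`rsig6_free_cpl`, `bsig6_free_cpl`) and `sumFW6_free_nonneg_of_le_half`
(`w e ∈ [0, ½]`).  Every ray of the four-mark deletion–contraction cone is thereby a theorem at every edge
probability on one side of `½` (`C041TriDomExcessWeightedFourRays`).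
-/

namespace PercRepro

namespace ZoneZ

namespace MultiExit

open ZoneData Finset

variable {V₁ E₁ U₁ U₂ : Type} (Z₁ : ZoneData V₁ E₁ U₁ U₂) (u u' u'' a₁ : V₁)

variable [DecidableEq E₁]

/-! ## The weighted sum and its recursion -/

variable [Fintype E₁]

/-- The weighted sum of `F` at the forced red pattern and the blue pattern of the four marks. -/
noncomputable def sumFW6 (F : P6 → P6 → ℤ) (R : E₁ → Prop) (st : E₁ → EStat) (w : E₁ → ℚ) : ℚ :=
  ∑ ω : E₁ → Bool, cwt w ω * (F (rsigF6 Z₁ u u' u'' a₁ R st ω) (bsig6 Z₁ u u' u'' a₁ st ω) : ℚ)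

/-- Colouring `f` red or blue: the two weighted summands of the recursion. -/
theorem summandFW6_add_flip (F : P6 → P6 → ℤ) (R : E₁ → Prop) (st : E₁ → EStat) (w : E₁ → ℚ) (f : E₁)
    (hf : st f = .free) (ω : E₁ → Bool) :
    cwt w ω * (F (rsigF6 Z₁ u u' u'' a₁ R st ω) (bsig6 Z₁ u u' u'' a₁ st ω) : ℚ)
        + cwt w (flipC f ω) *
          (F (rsigF6 Z₁ u u' u'' a₁ R st (flipC f ω)) (bsig6 Z₁ u u' u'' a₁ st (flipC f ω)) : ℚ) =
      cwt' f w ω * (w f * (F (rsigF6 Z₁ u u' u'' a₁ R (Function.update st f .double) ω)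
          (bsig6 Z₁ u u' u'' a₁ (Function.update st f .absent) ω) : ℚ)
        + (1 - w f) * (F (rsigF6 Z₁ u u' u'' a₁ R (Function.update st f .absent) ω)
          (bsig6 Z₁ u u' u'' a₁ (Function.update st f .double) ω) : ℚ)) := by
  have hd : EStat.double ≠ EStat.free := by decide
  have ha : EStat.absent ≠ EStat.free := by decide
  rw [cwt_eq f w ω, cwt_eq f w (flipC f ω), cwt'_flip, flipC_apply_self]
  by_cases hω : ω f = true
  · have hω' : flipC f ω f = false := by simp [flipC_apply_self, hω]
    rw [rsigF6_congr Z₁ u u' u'' a₁ R R (RAdjF_of_true Z₁ R hf hω),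
      bsig6_congr Z₁ u u' u'' a₁ (BAdjS_of_true Z₁ hf hω),
      rsigF6_congr Z₁ u u' u'' a₁ R R (RAdjF_of_false Z₁ R hf hω'),
      bsig6_congr Z₁ u u' u'' a₁ (BAdjS_of_false Z₁ hf hω')]
    unfold flipC
    rw [rsigF6_congr Z₁ u u' u'' a₁ R R (RAdjF_update_nonfree Z₁ R st f ha ω _),
      bsig6_congr Z₁ u u' u'' a₁ (BAdjS_update_nonfree Z₁ st f hd ω _)]
    simp only [hω, wt, Bool.not_true, if_true, Bool.false_eq_true, if_false]
    ring
  · have hω0 : ω f = false := by simpa using hω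
    have hω' : flipC f ω f = true := by simp [flipC_apply_self, hω0]
    rw [rsigF6_congr Z₁ u u' u'' a₁ R R (RAdjF_of_false Z₁ R hf hω0),
      bsig6_congr Z₁ u u' u'' a₁ (BAdjS_of_false Z₁ hf hω0),
      rsigF6_congr Z₁ u u' u'' a₁ R R (RAdjF_of_true Z₁ R hf hω'),
      bsig6_congr Z₁ u u' u'' a₁ (BAdjS_of_true Z₁ hf hω')]
    unfold flipC
    rw [rsigF6_congr Z₁ u u' u'' a₁ R R (RAdjF_update_nonfree Z₁ R st f hd ω _),
      bsig6_congr Z₁ u u' u'' a₁ (BAdjS_update_nonfree Z₁ st f ha ω _)]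
    simp only [hω0, wt, Bool.not_false, if_true, Bool.false_eq_true, if_false]
    ring

/-- Twice the weighted sum at a free edge `f`, with the weight of `f` split off. -/
theorem two_mul_sumFW6 (F : P6 → P6 → ℤ) (R : E₁ → Prop) (st : E₁ → EStat) (w : E₁ → ℚ) (f : E₁)
    (hf : st f = .free) :
    2 * sumFW6 Z₁ u u' u'' a₁ F R st w = ∑ ω : E₁ → Bool, cwt' f w ω *
      (w f * (F (rsigF6 Z₁ u u' u'' a₁ R (Function.update st f .double) ω)
          (bsig6 Z₁ u u' u'' a₁ (Function.update st f .absent) ω) : ℚ)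
        + (1 - w f) * (F (rsigF6 Z₁ u u' u'' a₁ R (Function.update st f .absent) ω)
          (bsig6 Z₁ u u' u'' a₁ (Function.update st f .double) ω) : ℚ)) := by
  have hflip : ∑ ω : E₁ → Bool, cwt w ω * (F (rsigF6 Z₁ u u' u'' a₁ R st ω) (bsig6 Z₁ u u' u'' a₁ st ω) : ℚ) =
      ∑ ω : E₁ → Bool, cwt w (flipC f ω) *
        (F (rsigF6 Z₁ u u' u'' a₁ R st (flipC f ω)) (bsig6 Z₁ u u' u'' a₁ st (flipC f ω)) : ℚ) :=
    (Equiv.sum_comp (flipPerm f)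
      (fun ω => cwt w ω * (F (rsigF6 Z₁ u u' u'' a₁ R st ω) (bsig6 Z₁ u u' u'' a₁ st ω) : ℚ))).symm
  have h2 : 2 * sumFW6 Z₁ u u' u'' a₁ F R st w = ∑ ω : E₁ → Bool,
      (cwt w ω * (F (rsigF6 Z₁ u u' u'' a₁ R st ω) (bsig6 Z₁ u u' u'' a₁ st ω) : ℚ)
        + cwt w (flipC f ω) *
          (F (rsigF6 Z₁ u u' u'' a₁ R st (flipC f ω)) (bsig6 Z₁ u u' u'' a₁ st (flipC f ω)) : ℚ)) := by
    rw [Finset.sum_add_distrib, ← hflip, sumFW6]; ring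
  rw [h2]
  exact Finset.sum_congr rfl fun ω _ => summandFW6_add_flip Z₁ u u' u'' a₁ F R st w f hf ω

/-- Twice the weighted sum of a status in which `f` is not free, with the weight of `f` removed. -/
theorem two_mul_sumFW6_nonfree (F : P6 → P6 → ℤ) (R : E₁ → Prop) (st : E₁ → EStat) (w : E₁ → ℚ) (f : E₁)
    {s : EStat} (hs : s ≠ .free) :
    2 * sumFW6 Z₁ u u' u'' a₁ F R (Function.update st f s) w = ∑ ω : E₁ → Bool, cwt' f w ω *
      (F (rsigF6 Z₁ u u' u'' a₁ R (Function.update st f s) ω)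
        (bsig6 Z₁ u u' u'' a₁ (Function.update st f s) ω) : ℚ) := by
  unfold sumFW6
  refine two_mul_sum_cwt_eq f w _ fun ω => ?_
  unfold flipC
  rw [rsigF6_congr Z₁ u u' u'' a₁ R R (RAdjF_update_nonfree Z₁ R st f hs ω _),
    bsig6_congr Z₁ u u' u'' a₁ (BAdjS_update_nonfree Z₁ st f hs ω _)]

/-- **THE WEIGHTED RECURSION AT FOUR MARKS** (as an inequality), at a free edge `f` of probability `p = w f ∈ [0, 1]`:
the weighted sum is at least `(2p − 1)` times the sum with `f` forced red plus `(1 − p)` times the sum of the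
deletion plus the sum of the contraction. -/
theorem sumFW6_rec_ge {F : P6 → P6 → ℤ} (hF : DCAdmissible6 F) (R : E₁ → Prop) (st : E₁ → EStat) (w : E₁ → ℚ)
    (hw : ∀ e, 0 ≤ w e ∧ w e ≤ 1) (f : E₁) (hf : st f = .free) :
    (2 * w f - 1) * sumFW6 Z₁ u u' u'' a₁ F (fun e => R e ∨ e = f) (Function.update st f .absent) w
      + (1 - w f) * (sumFW6 Z₁ u u' u'' a₁ F R (Function.update st f .absent) w
        + sumFW6 Z₁ u u' u'' a₁ F R (Function.update st f .double) w) ≤ sumFW6 Z₁ u u' u'' a₁ F R st w := by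
  have hd : EStat.double ≠ EStat.free := by decide
  have ha : EStat.absent ≠ EStat.free := by decide
  have hT := two_mul_sumFW6 Z₁ u u' u'' a₁ F R st w f hf
  have hA := two_mul_sumFW6_nonfree Z₁ u u' u'' a₁ F R st w f ha
  have hD := two_mul_sumFW6_nonfree Z₁ u u' u'' a₁ F R st w f hd
  have hF' := two_mul_sumFW6_nonfree Z₁ u u' u'' a₁ F (fun e => R e ∨ e = f) st w f ha
  simp only [rsigF6_congr Z₁ u u' u'' a₁ _ R (RAdjF_forced_eq Z₁ R st f _)] at hF'
  have h1w : 0 ≤ 1 - w f := by linarith [(hw f).2]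
  have hpt : ∑ ω : E₁ → Bool, cwt' f w ω * ((2 * w f - 1) *
        (F (rsigF6 Z₁ u u' u'' a₁ R (Function.update st f .double) ω)
          (bsig6 Z₁ u u' u'' a₁ (Function.update st f .absent) ω) : ℚ)
      + (1 - w f) * ((F (rsigF6 Z₁ u u' u'' a₁ R (Function.update st f .absent) ω)
          (bsig6 Z₁ u u' u'' a₁ (Function.update st f .absent) ω) : ℚ)
        + (F (rsigF6 Z₁ u u' u'' a₁ R (Function.update st f .double) ω)
          (bsig6 Z₁ u u' u'' a₁ (Function.update st f .double) ω) : ℚ))) ≤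
      ∑ ω : E₁ → Bool, cwt' f w ω *
      (w f * (F (rsigF6 Z₁ u u' u'' a₁ R (Function.update st f .double) ω)
          (bsig6 Z₁ u u' u'' a₁ (Function.update st f .absent) ω) : ℚ)
        + (1 - w f) * (F (rsigF6 Z₁ u u' u'' a₁ R (Function.update st f .absent) ω)
          (bsig6 Z₁ u u' u'' a₁ (Function.update st f .double) ω) : ℚ)) := by
    refine Finset.sum_le_sum fun ω _ => mul_le_mul_of_nonneg_left ?_ (cwt'_nonneg hw f ω)
    have hg := hF.key _ _ _ _ ⟨trans6_rsigF6 Z₁ u u' u'' a₁ R (Function.update st f .absent) ω,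
      trans6_rsigF6 Z₁ u u' u'' a₁ R (Function.update st f .double) ω,
      trans6_bsig6 Z₁ u u' u'' a₁ (Function.update st f .absent) ω,
      trans6_bsig6 Z₁ u u' u'' a₁ (Function.update st f .double) ω,
      le6_rsigF6 Z₁ u u' u'' a₁ R st f ω, le6_bsig6 Z₁ u u' u'' a₁ st f ω⟩
    have hg' : (0 : ℚ) ≤ (F (rsigF6 Z₁ u u' u'' a₁ R (Function.update st f .double) ω)
          (bsig6 Z₁ u u' u'' a₁ (Function.update st f .absent) ω) : ℚ)
        + (F (rsigF6 Z₁ u u' u'' a₁ R (Function.update st f .absent) ω)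
          (bsig6 Z₁ u u' u'' a₁ (Function.update st f .double) ω) : ℚ)
        - (F (rsigF6 Z₁ u u' u'' a₁ R (Function.update st f .absent) ω)
          (bsig6 Z₁ u u' u'' a₁ (Function.update st f .absent) ω) : ℚ)
        - (F (rsigF6 Z₁ u u' u'' a₁ R (Function.update st f .double) ω)
          (bsig6 Z₁ u u' u'' a₁ (Function.update st f .double) ω) : ℚ) := by
      exact_mod_cast (by linarith : (0 : ℤ) ≤ F (rsigF6 Z₁ u u' u'' a₁ R (Function.update st f .double) ω)
          (bsig6 Z₁ u u' u'' a₁ (Function.update st f .absent) ω)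
        + F (rsigF6 Z₁ u u' u'' a₁ R (Function.update st f .absent) ω)
          (bsig6 Z₁ u u' u'' a₁ (Function.update st f .double) ω)
        - F (rsigF6 Z₁ u u' u'' a₁ R (Function.update st f .absent) ω)
          (bsig6 Z₁ u u' u'' a₁ (Function.update st f .absent) ω)
        - F (rsigF6 Z₁ u u' u'' a₁ R (Function.update st f .double) ω)
          (bsig6 Z₁ u u' u'' a₁ (Function.update st f .double) ω))
    nlinarith [mul_nonneg h1w hg']
  have hsplit : ∑ ω : E₁ → Bool, cwt' f w ω * ((2 * w f - 1) *
        (F (rsigF6 Z₁ u u' u'' a₁ R (Function.update st f .double) ω)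
          (bsig6 Z₁ u u' u'' a₁ (Function.update st f .absent) ω) : ℚ)
      + (1 - w f) * ((F (rsigF6 Z₁ u u' u'' a₁ R (Function.update st f .absent) ω)
          (bsig6 Z₁ u u' u'' a₁ (Function.update st f .absent) ω) : ℚ)
        + (F (rsigF6 Z₁ u u' u'' a₁ R (Function.update st f .double) ω)
          (bsig6 Z₁ u u' u'' a₁ (Function.update st f .double) ω) : ℚ))) =
      (2 * w f - 1) * ∑ ω : E₁ → Bool, cwt' f w ω *
        (F (rsigF6 Z₁ u u' u'' a₁ R (Function.update st f .double) ω)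
          (bsig6 Z₁ u u' u'' a₁ (Function.update st f .absent) ω) : ℚ)
      + (1 - w f) * (∑ ω : E₁ → Bool, cwt' f w ω *
          (F (rsigF6 Z₁ u u' u'' a₁ R (Function.update st f .absent) ω)
            (bsig6 Z₁ u u' u'' a₁ (Function.update st f .absent) ω) : ℚ)
        + ∑ ω : E₁ → Bool, cwt' f w ω *
          (F (rsigF6 Z₁ u u' u'' a₁ R (Function.update st f .double) ω)
            (bsig6 Z₁ u u' u'' a₁ (Function.update st f .double) ω) : ℚ)) := by
    rw [mul_add, Finset.mul_sum, Finset.mul_sum, Finset.mul_sum, ← Finset.sum_add_distrib,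
      ← Finset.sum_add_distrib]
    exact Finset.sum_congr rfl fun ω _ => by ring
  rw [hsplit, ← hF', ← hA, ← hD, ← hT] at hpt
  linarith

/-- **THE METHOD AT EVERY EDGE PROBABILITY, FOUR MARKS**: for an admissible symmetric functional, every status, every
forced-red set and all edge probabilities in `[½, 1]`, the weighted sum is non-negative. -/
theorem sumFW6_nonneg {F : P6 → P6 → ℤ} (hF : DCAdmissible6 F) (hsym : ∀ s t, Trans6 s → Trans6 t → F s t = F t s)
    (R : E₁ → Prop) (st : E₁ → EStat) (w : E₁ → ℚ) (hw : ∀ e, 1 / 2 ≤ w e ∧ w e ≤ 1) :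
    0 ≤ sumFW6 Z₁ u u' u'' a₁ F R st w := by
  have hw01 : ∀ e, 0 ≤ w e ∧ w e ≤ 1 := fun e => ⟨by linarith [(hw e).1], (hw e).2⟩
  suffices h : ∀ n : ℕ, ∀ (R : E₁ → Prop) (st : E₁ → EStat), nfree st = n →
      0 ≤ sumFW6 Z₁ u u' u'' a₁ F R st w from h _ R st rfl
  intro n
  induction n with
  | zero =>
    intro R st hst
    have hno : ∀ e, st e ≠ .free := by
      intro e he
      have : e ∈ (univ.filter fun e => st e = .free) := by simp [he]
      rw [Finset.card_eq_zero.mp hst] at this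
      simp at this
    unfold sumFW6
    refine Finset.sum_nonneg fun ω _ => mul_nonneg (cwt_nonneg hw01 ω) ?_
    exact_mod_cast hF.nonneg_of_le6 hsym (trans6_rsigF6 Z₁ u u' u'' a₁ R st ω)
      (trans6_bsig6 Z₁ u u' u'' a₁ st ω) (le6_bsig6_rsigF6_of_nofree Z₁ u u' u'' a₁ R st hno ω)
  | succ n ih =>
    intro R st hst
    have hne : (univ.filter fun e => st e = .free).Nonempty := by
      rw [← Finset.card_pos]; unfold nfree at hst; omega
    obtain ⟨f, hf⟩ := hne
    have hf' : st f = .free := (Finset.mem_filter.mp hf).2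
    have h1 := ih (fun e => R e ∨ e = f) (Function.update st f .absent) (by
      have := nfree_update hf' (s := .absent) (by decide); omega)
    have h2 := ih R (Function.update st f .absent) (by
      have := nfree_update hf' (s := .absent) (by decide); omega)
    have h3 := ih R (Function.update st f .double) (by
      have := nfree_update hf' (s := .double) (by decide); omega)
    have hrec := sumFW6_rec_ge Z₁ u u' u'' a₁ hF R st w hw01 f hf'
    have hc1 : 0 ≤ 2 * w f - 1 := by linarith [(hw f).1]
    have hc2 : 0 ≤ 1 - w f := by linarith [(hw f).2]
    have := add_nonneg (mul_nonneg hc1 h1) (mul_nonneg hc2 (add_nonneg h2 h3))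
    linarith

/-! ## The host with every edge free -/

/-- **THE METHOD AT EVERY EDGE PROBABILITY ≥ ½, FOUR MARKS, ALL EDGES FREE**. -/
theorem sumFW6_free_nonneg {F : P6 → P6 → ℤ} (hF : DCAdmissible6 F)
    (hsym : ∀ s t, Trans6 s → Trans6 t → F s t = F t s) (w : E₁ → ℚ) (hw : ∀ e, 1 / 2 ≤ w e ∧ w e ≤ 1) :
    0 ≤ ∑ ω : E₁ → Bool, cwt w ω * (F (rsig6 Z₁ u u' u'' a₁ (fun _ => EStat.free) ω)
      (bsig6 Z₁ u u' u'' a₁ (fun _ => EStat.free) ω) : ℚ) := by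
  have h := sumFW6_nonneg Z₁ u u' u'' a₁ hF hsym (fun _ => False) (fun _ => EStat.free) w hw
  unfold sumFW6 at h
  simpa only [rsigF6_false] using h

omit [DecidableEq E₁] [Fintype E₁] in
/-- The complementation exchanges the two adjacencies of the all-free status. -/
theorem RAdjS_free_cpl (ω : E₁ → Bool) :
    RAdjS Z₁ (fun _ => EStat.free) (ZoneData.cpl ω) = BAdjS Z₁ (fun _ => EStat.free) ω := by
  funext x y
  refine propext (exists_congr fun e => and_congr_right fun _ => ?_)
  simp [redE, blueE, ZoneData.cpl]

omit [DecidableEq E₁] [Fintype E₁] in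
/-- The complementation exchanges the patterns: the red pattern of the complement is the blue pattern. -/
theorem rsig6_free_cpl (ω : E₁ → Bool) :
    rsig6 Z₁ u u' u'' a₁ (fun _ => EStat.free) (ZoneData.cpl ω) = bsig6 Z₁ u u' u'' a₁ (fun _ => EStat.free) ω := by
  simp only [rsig6, bsig6, RdS, MgS, Prod.mk.injEq, decide_eq_decide, RAdjS_free_cpl, iff_self, and_self]

omit [DecidableEq E₁] [Fintype E₁] in
/-- The complementation exchanges the patterns: the blue pattern of the complement is the red pattern. -/
theorem bsig6_free_cpl (ω : E₁ → Bool) :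
    bsig6 Z₁ u u' u'' a₁ (fun _ => EStat.free) (ZoneData.cpl ω) = rsig6 Z₁ u u' u'' a₁ (fun _ => EStat.free) ω := by
  have h : BAdjS Z₁ (fun _ => EStat.free) (ZoneData.cpl ω) = RAdjS Z₁ (fun _ => EStat.free) ω := by
    funext x y
    refine propext (exists_congr fun e => and_congr_right fun _ => ?_)
    simp [redE, blueE, ZoneData.cpl]
  simp only [rsig6, bsig6, RdS, MgS, Prod.mk.injEq, decide_eq_decide, h, iff_self, and_self]

/-- The complementation: the weighted sum of a symmetric functional at `w` equals the one at `1 − w`. -/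
theorem sumFW6_free_cpl (F : P6 → P6 → ℤ) (hsym : ∀ s t, Trans6 s → Trans6 t → F s t = F t s) (w : E₁ → ℚ) :
    ∑ ω : E₁ → Bool, cwt w ω * (F (rsig6 Z₁ u u' u'' a₁ (fun _ => EStat.free) ω)
        (bsig6 Z₁ u u' u'' a₁ (fun _ => EStat.free) ω) : ℚ) =
      ∑ ω : E₁ → Bool, cwt (fun e => 1 - w e) ω * (F (rsig6 Z₁ u u' u'' a₁ (fun _ => EStat.free) ω)
        (bsig6 Z₁ u u' u'' a₁ (fun _ => EStat.free) ω) : ℚ) := by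
  have hinv : Function.Involutive (ZoneData.cpl (E := E₁)) := ZoneData.cpl_cpl
  rw [← Equiv.sum_comp hinv.toPerm (fun ω => cwt w ω * (F (rsig6 Z₁ u u' u'' a₁ (fun _ => EStat.free) ω)
    (bsig6 Z₁ u u' u'' a₁ (fun _ => EStat.free) ω) : ℚ))]
  refine Finset.sum_congr rfl fun ω _ => ?_
  simp only [Function.Involutive.coe_toPerm]
  rw [cwt_cpl, rsig6_free_cpl, bsig6_free_cpl,
    hsym _ _ (trans6_bsig6 Z₁ u u' u'' a₁ _ ω) (trans6_rsig6 Z₁ u u' u'' a₁ _ ω)]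

/-- **THE METHOD AT EVERY EDGE PROBABILITY ≤ ½, FOUR MARKS, ALL EDGES FREE** (by complementation). -/
theorem sumFW6_free_nonneg_of_le_half {F : P6 → P6 → ℤ} (hF : DCAdmissible6 F)
    (hsym : ∀ s t, Trans6 s → Trans6 t → F s t = F t s) (w : E₁ → ℚ) (hw : ∀ e, 0 ≤ w e ∧ w e ≤ 1 / 2) :
    0 ≤ ∑ ω : E₁ → Bool, cwt w ω * (F (rsig6 Z₁ u u' u'' a₁ (fun _ => EStat.free) ω)
      (bsig6 Z₁ u u' u'' a₁ (fun _ => EStat.free) ω) : ℚ) := by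
  rw [sumFW6_free_cpl Z₁ u u' u'' a₁ F hsym]
  exact sumFW6_free_nonneg Z₁ u u' u'' a₁ hF hsym (fun e => 1 - w e) fun e =>
    ⟨by linarith [(hw e).2], by linarith [(hw e).1]⟩

end MultiExit

end ZoneZ

end PercRepro
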